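import Mathlib
import Literature.Computability.AlgebraicComplexity.IMMInVPProofs
import Summits.ValiantsHypothesis.ValiantsHypothesis.Theorems.BarrierLeverDefinableEquationsPartialDerivativeWallOrderOneAllShifts

/-!
# Route BarrierLever — method wall #1b, part 3: first-order shifted partials are saturated at
# EVERY shift already INSIDE THE OPEN RUNG `SmallCircuits ℂ n 2`, by the binomial staircase
# `B_n = Σ_i (1 + x_i)^n` (crux `DefinableEquations` stmt-8745 / item `SingleSizeEquations`
# stmt-8749; val-np-p5 g12)

Part 2 (`…OrderOneAllShifts.lean`, val-np-p5 g11) attains the universal order-one ceiling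
`rank g_{(1,·)[τ]} ≤ n · #{deg-τ monomials}` at every shift `τ` with the power-sum staircase
`S_n = Σ_{d ≤ n} Σ_i x_i^d`, whose cost `≈ 2n²` only places it in `SmallCircuits ℂ n b` for `b ≥ 4`.
Here the same ceiling is attained by `B_n = Σ_i (1 + x_i)^n`, which costs `≤ n (2⌊log₂ n⌋ + 2)`
gates (binary powering), hence lies in `SmallCircuits ℂ n 2` for every `n ≥ 6`: since
`∂_i B_n = n Σ_{d<n} C(n-1,d) x_i^d` has ALL `n` powers with nonzero coefficients, a syzygy
`Σ_i a_i ∂_i B_n = 0` (`a_i` forms of degree `τ`) splits by degree into the full `n × n` Vandermonde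
system `Σ_i a_i x_i^d = 0`, `d < n`, exactly as for `S_n`.

* `linearIndependent_shifted_of_pderiv_eq` — the g11 Vandermonde argument for ANY `g` with
  `∂_i g = Σ_{d<n} w_d x_i^d`, all `w_d ≠ 0` (staircase: `w_d = d+1`; binomial: `n·C(n-1,d)`);
* `pderiv_binomialSum`, `shiftedPartialsRank_one_binomialSum_eq` (`= n · #{deg-τ monomials}` for
  every `τ`), `shiftedPartialsRank_one_le_binomialSum`;
* `complexity_X_pow_le_two_mul_log` (`L(x^D) ≤ 2⌊log₂ D⌋`, repeated squaring with sharing),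
  `complexity_pow_le_add_two_mul_log` (`L(f^D) ≤ L(f) + 2⌊log₂ D⌋`),
  `complexity_binomialSum_le` (`≤ n (2⌊log₂ n⌋ + 2)`), `two_mul_log_add_two_le` (`2⌊log₂ n⌋ + 2 ≤ n`, `n ≥ 6`),
  `binomialSum_mem_smallCircuits` (`b ≥ 2`, `n ≥ 6`);
* **`no_shiftedRankMethod_smallCircuits_two_orderOne_allShifts`** — for `n ≥ 6` and EVERY `b ≥ 2`
  there is no shift `τ` and threshold `r` with `rank f_{(1,·)[τ]} < r` on `SmallCircuits ℂ n b` and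
  `rank g_{(1,·)[τ]} ≥ r` for some `g` (any `g`): the order-one row of the shifted-partials chart is
  closed at the open rung `b = 2` itself (parts 1–2 needed `τ ≤ n - 3` resp. `b ≥ 4`).

WHAT THIS IS NOT: nothing on the crux's verdict (`b = 2` OPEN, Chatterjee–Tengse 2023 §1.3
direction 2) or on `VP ≠ VNP`; a wall kills a rank THRESHOLD method, not every polynomial in an
ideal of minors.  Orders `2 ≤ e < ⌊n/2⌋` with `τ ≥ 1` remain unwalled in the kernel.  No
definitions, no named facts; standard axioms.
-/

-- `Summit.ValiantsHypothesis.ValiantsHypothesis.…` repeats a component by the D-0017 layout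
-- (single-conjunct summit), which the `dupNamespace` linter flags; the name is mandated.
set_option linter.dupNamespace false

noncomputable section

namespace Summit.ValiantsHypothesis.ValiantsHypothesis.Theorems.BarrierLeverDefinableEquations

open MvPolynomial
open Literature.Computability.AlgebraicComplexity
open Literature.Barriers.ValiantsHypothesis
open scoped BigOperators

namespace PartialDerivativeWall

section Binomial

variable {K : Type*} [Field K] {n : ℕ}

/-! ## §5 The Vandermonde argument for any `g` with `∂_i g = Σ_{d<n} w_d x_i^d`, `w_d ≠ 0` -/

/-- **Generic form of the g11 staircase argument.**  If `∂_i g = Σ_{d<n} w_d x_i^d` for every `i`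
with all `w_d ≠ 0` (`d < n`), then the generators `x^β ∂_i g` (`deg β = τ`, `i ≤ n`) of the
order-one shifted partials of `g` are linearly independent for EVERY shift `τ`: a relation
`Σ_i a_i ∂_i g = 0` with `a_i` forms of degree `τ` splits by degree into `w_d Σ_i a_i x_i^d = 0`
(`d < n`), a Vandermonde system in the domain `K[x]`. [folklore] -/
theorem linearIndependent_shifted_of_pderiv_eq {g : MvPolynomial (Fin n) K} {w : ℕ → K}
    (hg : ∀ i : Fin n, pderiv i g = ∑ d ∈ Finset.range n, monomial (Finsupp.single i d) (w d))
    (hw : ∀ d < n, w d ≠ 0) (τ : ℕ) :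
    LinearIndependent K (fun p : Fin n × ↥((Finset.univ : Finset (Fin n)).finsuppAntidiag τ) =>
      monomial (p.2 : Fin n →₀ ℕ) (1 : K) * pderiv p.1 g) := by
  classical
  rw [Fintype.linearIndependent_iff]
  intro c hc
  -- the degree-`τ` forms `a_i = Σ_β c(i,β) x^β`
  set a : Fin n → MvPolynomial (Fin n) K :=
    fun i => ∑ β : ↥((Finset.univ : Finset (Fin n)).finsuppAntidiag τ),
      c (i, β) • monomial (β : Fin n →₀ ℕ) (1 : K) with ha
  have haHom : ∀ i, (a i).IsHomogeneous τ := fun i => by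
    refine IsHomogeneous.sum _ _ _ fun β _ => ?_
    rw [smul_monomial, smul_eq_mul, mul_one]
    exact isHomogeneous_monomial _ ((degree_eq_iff_mem_finsuppAntidiag _ τ).mpr β.2)
  -- `Σ_i a_i ∂_i g = 0`
  have hsum : ∑ i, a i * ∑ d' ∈ Finset.range n, monomial (Finsupp.single i d') (w d') = 0 := by
    rw [← hc, Fintype.sum_prod_type]
    refine Finset.sum_congr rfl fun i _ => ?_
    simp only [hg, ha, Finset.sum_mul, smul_mul_assoc]
  -- split by degree: the component of degree `τ + d` is `w_d · Σ_i a_i x_i^d`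
  have hdeg : ∀ d : Fin n, ∑ i, a i * (X i : MvPolynomial (Fin n) K) ^ (d : ℕ) = 0 := by
    intro d
    have hcomp := congrArg (homogeneousComponent (τ + d)) hsum
    rw [map_zero, map_sum] at hcomp
    have hhom : ∀ (i : Fin n) (d' : ℕ),
        (a i * monomial (Finsupp.single i d') (w d')).IsHomogeneous (τ + d') :=
      fun i d' => (haHom i).mul (isHomogeneous_monomial _ (by rw [Finsupp.degree_single]))
    have hterm : ∀ i, homogeneousComponent (τ + d)
        (a i * ∑ d' ∈ Finset.range n, monomial (Finsupp.single i d') (w d')) =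
        w d • (a i * X i ^ (d : ℕ)) := by
      intro i
      rw [Finset.mul_sum, map_sum, Finset.sum_eq_single (d : ℕ)]
      · rw [homogeneousComponent_of_mem ((mem_homogeneousSubmodule _ _).mpr (hhom i d)), if_pos rfl,
          X_pow_eq_monomial, ← mul_smul_comm, smul_monomial, smul_eq_mul, mul_one]
      · intro d' _ hne
        rw [homogeneousComponent_of_mem ((mem_homogeneousSubmodule _ _).mpr (hhom i d')), if_neg]
        omega
      · intro hd; exact absurd (Finset.mem_range.mpr d.2) hd
    simp only [hterm, ← Finset.smul_sum] at hcomp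
    exact (smul_eq_zero.mp hcomp).resolve_left (hw d d.2)
  have ha0 : a = 0 := eq_zero_of_sum_mul_X_pow_eq_zero a hdeg
  rintro ⟨i, β⟩
  have h := congrArg (coeff (β : Fin n →₀ ℕ)) (congrFun ha0 i)
  rw [coeff_sum_smul_monomial] at h
  simpa using h

/-- Rank form of the previous lemma: under the same hypothesis `rank g_{(1,·)[τ]}` attains the
universal ceiling `n · #{deg-τ monomials}` at every shift. [cite: LandsbergGCT2017, §6.2.2 (p. 158)] -/
theorem shiftedPartialsRank_one_eq_of_pderiv_eq [CharZero K] {g : MvPolynomial (Fin n) K} {w : ℕ → K}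
    (hg : ∀ i : Fin n, pderiv i g = ∑ d ∈ Finset.range n, monomial (Finsupp.single i d) (w d))
    (hw : ∀ d < n, w d ≠ 0) (τ : ℕ) :
    shiftedPartialsRank K 1 τ g = n * ((Finset.univ : Finset (Fin n)).finsuppAntidiag τ).card := by
  classical
  refine le_antisymm (shiftedPartialsRank_one_le τ g) ?_
  set ψ := fun p : Fin n × ↥((Finset.univ : Finset (Fin n)).finsuppAntidiag τ) =>
      monomial (p.2 : Fin n →₀ ℕ) (1 : K) * pderiv p.1 g with hψ
  have hli : LinearIndependent K ψ := linearIndependent_shifted_of_pderiv_eq hg hw τ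
  haveI := finite_span_shiftedPartials (K := K) 1 τ g
  have hsub : Set.range ψ ⊆ shiftedPartials 1 τ g := by
    rintro _ ⟨⟨i, β, hβ⟩, rfl⟩
    exact ⟨[i], β, rfl, (degree_eq_iff_mem_finsuppAntidiag β τ).mpr hβ, by simp [hψ]⟩
  unfold shiftedPartialsRank
  calc n * ((Finset.univ : Finset (Fin n)).finsuppAntidiag τ).card
      = Fintype.card (Fin n × ↥((Finset.univ : Finset (Fin n)).finsuppAntidiag τ)) := by
        rw [Fintype.card_prod, Fintype.card_fin, Fintype.card_coe]
    _ = Module.finrank K (Submodule.span K (Set.range ψ)) := (finrank_span_eq_card hli).symm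
    _ ≤ Module.finrank K (Submodule.span K (shiftedPartials 1 τ g)) :=
        Submodule.finrank_mono (Submodule.span_mono hsub)

/-! ## §6 The binomial staircase `B_n = Σ_j (1 + x_j)^n` -/

/-- `∂_i Σ_j (1 + x_j)^D = Σ_{d<D} D·C(D-1,d) x_i^d` (binomial theorem). [folklore] -/
theorem pderiv_binomialSum (D : ℕ) (i : Fin n) :
    pderiv i (∑ j : Fin n, ((1 : MvPolynomial (Fin n) K) + X j) ^ D) =
      ∑ d ∈ Finset.range D, monomial (Finsupp.single i d) (((D * (D - 1).choose d : ℕ) : K)) := by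
  classical
  -- `∂_i (1 + x_j)^D = D (1 + x_j)^{D-1} ∂_i x_j`
  have hder : ∀ j : Fin n, pderiv i (((1 : MvPolynomial (Fin n) K) + X j) ^ D) =
      (D : MvPolynomial (Fin n) K) * ((1 : MvPolynomial (Fin n) K) + X j) ^ (D - 1) * pderiv i (X j) := by
    intro j
    rw [(pderiv i).leibniz_pow, map_add, Derivation.map_one_eq_zero, zero_add, smul_eq_mul,
      nsmul_eq_mul, mul_assoc]
  rw [map_sum, Finset.sum_eq_single i]
  · rw [hder, pderiv_X_self, mul_one]
    cases D with
    | zero => simp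
    | succ d =>
      rw [Nat.add_sub_cancel, add_comm (1 : MvPolynomial (Fin n) K), add_pow, Finset.mul_sum]
      refine Finset.sum_congr rfl fun m _ => ?_
      rw [one_pow, mul_one, X_pow_eq_monomial, ← C_eq_coe_nat, ← C_eq_coe_nat,
        mul_comm (monomial _ _) (C _), ← mul_assoc, ← C_mul, C_mul_monomial, mul_one, ← Nat.cast_mul]
  · intro j _ hji
    rw [hder, pderiv_X_of_ne hji, mul_zero]
  · intro h; exact absurd (Finset.mem_univ i) h

/-- For `B_n = Σ_j (1 + x_j)^n` the order-one ceiling is attained at EVERY shift: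
`rank (B_n)_{(1,·)[τ]} = n · #{deg-τ monomials}` (all `n` coefficients `n·C(n-1,d)`, `d < n`, of
`∂_i B_n` are nonzero in characteristic `0`). [cite: LandsbergGCT2017, §6.2.2 (p. 158)] -/
theorem shiftedPartialsRank_one_binomialSum_eq [CharZero K] (τ : ℕ) :
    shiftedPartialsRank K 1 τ (∑ j : Fin n, ((1 : MvPolynomial (Fin n) K) + X j) ^ n) =
      n * ((Finset.univ : Finset (Fin n)).finsuppAntidiag τ).card := by
  refine shiftedPartialsRank_one_eq_of_pderiv_eq (w := fun d => ((n * (n - 1).choose d : ℕ) : K))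
    (fun i => pderiv_binomialSum n i) (fun d hd => ?_) τ
  have h1 : n ≠ 0 := by omega
  have h2 : (n - 1).choose d ≠ 0 := (Nat.choose_pos (by omega)).ne'
  exact_mod_cast Nat.mul_ne_zero h1 h2

/-- **Saturation at order one, every shift, by `B_n`**: `rank g_{(1,·)[τ]} ≤ rank (B_n)_{(1,·)[τ]}`
for every `g ∈ K[x_1..x_n]` and every `τ`. [cite: GesmundoLandsberg2017, Thm. 4 and §1] -/
theorem shiftedPartialsRank_one_le_binomialSum [CharZero K] (τ : ℕ) (g : MvPolynomial (Fin n) K) :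
    shiftedPartialsRank K 1 τ g ≤
      shiftedPartialsRank K 1 τ (∑ j : Fin n, ((1 : MvPolynomial (Fin n) K) + X j) ^ n) := by
  rw [shiftedPartialsRank_one_binomialSum_eq]
  exact shiftedPartialsRank_one_le τ g

/-- `deg Σ_j (1 + x_j)^D ≤ D`. [folklore] -/
theorem totalDegree_binomialSum_le (D : ℕ) :
    (∑ j : Fin n, ((1 : MvPolynomial (Fin n) K) + X j) ^ D).totalDegree ≤ D := by
  refine (totalDegree_finsetSum _ _).trans (Finset.sup_le fun j _ => ?_)
  refine (totalDegree_pow _ _).trans ?_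
  have h : (((1 : MvPolynomial (Fin n) K) + X j)).totalDegree ≤ 1 :=
    (totalDegree_add _ _).trans (max_le (by simp) (by rw [totalDegree_X]))
  simpa using Nat.mul_le_mul_left D h

/-! ## §7 `B_n` is cheap: repeated squaring with sharing -/

/-- **Binary powering**: `L(x^D) ≤ 2⌊log₂ D⌋` for the univariate monomial `x^D` (compute
`x^{⌊D/2⌋}` once, square it, multiply by `x` if `D` is odd; substitution `complexity_aeval_le` keeps
the sharing). [cite: Burgisser2000, §2.1] -/
theorem complexity_X_pow_le_two_mul_log (D : ℕ) :
    complexity ((X () : MvPolynomial Unit K) ^ D) ≤ 2 * Nat.log 2 D := by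
  induction D using Nat.strong_induction_on with
  | _ D ih =>
    rcases lt_or_ge D 2 with hD | hD
    · interval_cases D
      · rw [pow_zero, ← C_1, complexity_C_holds]; exact Nat.zero_le _
      · rw [pow_one, complexity_X_holds]; exact Nat.zero_le _
    · have hk : D / 2 < D := Nat.div_lt_self (by omega) one_lt_two
      have hlog : Nat.log 2 D = Nat.log 2 (D / 2) + 1 := Nat.log_of_one_lt_of_le one_lt_two hD
      have ihk := ih (D / 2) hk
      have hXX : complexity ((X true : MvPolynomial Bool K) * X true) ≤ 1 := by
        have h := complexity_mul_le_holds (X true : MvPolynomial Bool K) (X true)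
        rw [complexity_X_holds] at h
        simpa using h
      have hdm := Nat.div_add_mod D 2
      rcases Nat.mod_two_eq_zero_or_one D with h0 | h1
      · -- `x^D = (x^{D/2})²`
        have h := complexity_aeval_le ((X () : MvPolynomial Unit K) * X ())
          (fun _ => (X () : MvPolynomial Unit K) ^ (D / 2))
        rw [map_mul, aeval_X, ← pow_add, Fintype.sum_unique] at h
        have hDD : D / 2 + D / 2 = D := by omega
        rw [hDD] at h
        have hXX' : complexity ((X () : MvPolynomial Unit K) * X ()) ≤ 1 := by
          have h' := complexity_mul_le_holds (X () : MvPolynomial Unit K) (X ())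
          rw [complexity_X_holds] at h'
          simpa using h'
        omega
      · -- `x^D = (x^{D/2})² · x`
        have h := complexity_aeval_le ((X true : MvPolynomial Bool K) * X true * X false)
          (fun b => cond b ((X () : MvPolynomial Unit K) ^ (D / 2)) (X ()))
        rw [map_mul, map_mul, aeval_X, aeval_X, Fintype.sum_bool] at h
        simp only [cond_true, cond_false] at h
        rw [← pow_add, ← pow_succ, complexity_X_holds, add_zero] at h
        have hDD : D / 2 + D / 2 + 1 = D := by omega
        rw [hDD] at h
        have h3 : complexity ((X true : MvPolynomial Bool K) * X true * X false) ≤ 2 := by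
          have h' := complexity_mul_le_holds ((X true : MvPolynomial Bool K) * X true) (X false)
          rw [complexity_X_holds] at h'
          omega
        omega

/-- `L(f^D) ≤ L(f) + 2⌊log₂ D⌋` for every polynomial `f` (substitute `f` once into the univariate
circuit for `x^D`). [cite: Burgisser2000, §2.1] -/
theorem complexity_pow_le_add_two_mul_log {σ : Type*} (f : MvPolynomial σ K) (D : ℕ) :
    complexity (f ^ D) ≤ complexity f + 2 * Nat.log 2 D := by
  have h := complexity_aeval_le ((X () : MvPolynomial Unit K) ^ D) (fun _ => f)
  rw [map_pow, aeval_X, Fintype.sum_unique] at h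
  have h2 := complexity_X_pow_le_two_mul_log (K := K) D
  omega

/-- `L(B_D) = L(Σ_j (1 + x_j)^D) ≤ n (2⌊log₂ D⌋ + 2)` (`1 + x_j`: one gate; powering: `2⌊log₂ D⌋`;
summing: `n`). [cite: Burgisser2000, §2.1] -/
theorem complexity_binomialSum_le (D : ℕ) :
    complexity (∑ j : Fin n, ((1 : MvPolynomial (Fin n) K) + X j) ^ D) ≤ n * (2 * Nat.log 2 D + 2) := by
  classical
  refine (complexity_finset_sum_le _ _).trans ?_
  have h1 : ∀ j : Fin n, complexity (((1 : MvPolynomial (Fin n) K) + X j) ^ D) ≤ 2 * Nat.log 2 D + 1 := by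
    intro j
    have ha : complexity ((1 : MvPolynomial (Fin n) K) + X j) ≤ 1 := by
      have h := complexity_add_le_holds (C (1 : K) : MvPolynomial (Fin n) K) (X j)
      rw [complexity_C_holds, complexity_X_holds, C_1] at h
      omega
    have hb := complexity_pow_le_add_two_mul_log ((1 : MvPolynomial (Fin n) K) + X j) D
    omega
  calc ∑ j : Fin n, complexity (((1 : MvPolynomial (Fin n) K) + X j) ^ D) + (Finset.univ : Finset (Fin n)).card
      ≤ ∑ _j : Fin n, (2 * Nat.log 2 D + 1) + (Finset.univ : Finset (Fin n)).card :=
        Nat.add_le_add_right (Finset.sum_le_sum fun j _ => h1 j) _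
    _ = n * (2 * Nat.log 2 D + 2) := by simp; ring

/-- `2⌊log₂ n⌋ + 2 ≤ n` for `n ≥ 6` (`2L + 2 ≤ 2^L ≤ n` once `L = ⌊log₂ n⌋ ≥ 3`). [folklore] -/
theorem two_mul_log_add_two_le (hn : 6 ≤ n) : 2 * Nat.log 2 n + 2 ≤ n := by
  have hpow : 2 ^ Nat.log 2 n ≤ n := Nat.pow_log_le_self 2 (by omega)
  rcases lt_or_ge (Nat.log 2 n) 3 with hL | hL
  · omega
  · -- `2L + 2 ≤ 2^L` for `L ≥ 3`, by induction
    have key : ∀ L : ℕ, 3 ≤ L → 2 * L + 2 ≤ 2 ^ L := by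
      intro L hL3
      induction L, hL3 using Nat.le_induction with
      | base => norm_num
      | succ L hL3 ih =>
        have h2 : 2 ≤ 2 ^ L :=
          calc 2 = 2 ^ 1 := by norm_num
            _ ≤ 2 ^ L := Nat.pow_le_pow_right (by norm_num) (by omega)
        rw [pow_succ]
        omega
    exact (key _ hL).trans hpow

/-- `B_n = Σ_j (1 + x_j)^n ∈ SmallCircuits ℂ n b` for every `b ≥ 2` and `n ≥ 6`
(`n (2⌊log₂ n⌋ + 2) ≤ n² ≤ n^b`). [cite: ForbesShpilkaVolk2018, Cor. 5] -/
theorem binomialSum_mem_smallCircuits {b : ℕ} (hb : 2 ≤ b) (hn : 6 ≤ n) :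
    (∑ j : Fin n, ((1 : MvPolynomial (Fin n) ℂ) + X j) ^ n) ∈ SmallCircuits ℂ n b := by
  refine ⟨totalDegree_binomialSum_le n, (complexity_binomialSum_le n).trans ?_⟩
  calc n * (2 * Nat.log 2 n + 2) ≤ n * n := Nat.mul_le_mul_left n (two_mul_log_add_two_le hn)
    _ = n ^ 2 := (sq n).symm
    _ ≤ n ^ b := Nat.pow_le_pow_right (by omega) hb

/-! ## §8 The wall at the open rung `b = 2`, every shift -/

/-- A first-order threshold set containing `SmallCircuits ℂ n b` (`n ≥ 6`, `b ≥ 2`) is everything,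
at EVERY shift `τ`. [cite: GesmundoLandsberg2017, Thm. 4 and §1] -/
theorem sublevel_one_eq_univ_of_smallCircuits_allShifts {b τ r : ℕ} (hn : 6 ≤ n) (hb : 2 ≤ b)
    (h : ∀ f ∈ SmallCircuits ℂ n b, shiftedPartialsRank ℂ 1 τ f < r) :
    {g : MvPolynomial (Fin n) ℂ | shiftedPartialsRank ℂ 1 τ g < r} = Set.univ :=
  Set.eq_univ_of_forall fun g =>
    lt_of_le_of_lt (shiftedPartialsRank_one_le_binomialSum τ g) (h _ (binomialSum_mem_smallCircuits hb hn))

/-- **No first-order shifted-partials rank method against `SmallCircuits ℂ n b` for ANY `b ≥ 2`,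
ANY shift** (`n ≥ 6`): no `τ, r` with `rank f_{(1,·)[τ]} < r` on the class and
`rank g_{(1,·)[τ]} ≥ r` for some `g` (any `g`, any degree).  The order-one row of the
shifted-partials chart is thereby closed at the open rung `b = 2` itself (part 1: `τ ≤ n - 3`;
part 2: every `τ` but `b ≥ 4`). [cite: ForbesShpilkaVolk2018, Cor. 5] -/
theorem no_shiftedRankMethod_smallCircuits_two_orderOne_allShifts {b : ℕ} (hn : 6 ≤ n) (hb : 2 ≤ b) :
    ¬ ∃ τ r : ℕ, (∀ f ∈ SmallCircuits ℂ n b, shiftedPartialsRank ℂ 1 τ f < r) ∧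
      ∃ g : MvPolynomial (Fin n) ℂ, r ≤ shiftedPartialsRank ℂ 1 τ g := by
  rintro ⟨τ, r, hcls, g, hr⟩
  exact absurd ((shiftedPartialsRank_one_le_binomialSum τ g).trans_lt
    (hcls _ (binomialSum_mem_smallCircuits hb hn))) (not_lt.2 hr)

/-- The `n log n`-size form: `B_D = Σ_j (1 + x_j)^D` with `D ≤ n` has complexity
`≤ n (2⌊log₂ n⌋ + 2)`, so for NO shift `τ` can first-order shifted partials separate even the
class `{deg ≤ n, L ≤ n (2⌊log₂ n⌋ + 2)}` from anything (take `D = n`).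
[cite: ForbesShpilkaVolk2018, Cor. 5] -/
theorem no_shiftedRankMethod_nlogn_orderOne_allShifts :
    ¬ ∃ τ r : ℕ, (∀ f : MvPolynomial (Fin n) ℂ, f.totalDegree ≤ n →
        complexity f ≤ n * (2 * Nat.log 2 n + 2) → shiftedPartialsRank ℂ 1 τ f < r) ∧
      ∃ g : MvPolynomial (Fin n) ℂ, r ≤ shiftedPartialsRank ℂ 1 τ g := by
  rintro ⟨τ, r, hcls, g, hr⟩
  have hB := hcls (∑ j : Fin n, ((1 : MvPolynomial (Fin n) ℂ) + X j) ^ n)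
    (totalDegree_binomialSum_le n) (complexity_binomialSum_le n)
  exact absurd ((shiftedPartialsRank_one_le_binomialSum τ g).trans_lt hB) (not_lt.2 hr)

end Binomial

end PartialDerivativeWall

end Summit.ValiantsHypothesis.ValiantsHypothesis.Theorems.BarrierLeverDefinableEquations
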